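/-
Copyright (c) 2026 the pub-hodgecm-mathlib formalisation cell (harness21).  Prover seat hodgecm-mathlib-K2Liu-p02 (g10), Track B «K2-LIT» ∕ hLiu418
#184♮, Road I v3, unit U5 «THE CLOSE», FACE-D₀ (theta side, route (B3) «global unfolding»), brick B3-2c-idx, FILE 1∕2 «PRELIMINARIES»: the ADELIC Gram reading of the κ-model chirp
block and the reality of `tr(S_𝔸 · X_u)` — the GLOBAL twin of ★ p863978 `K2LiuFinChirpLocalGramReading` (FACE-D₀ desk cut, K2 bus 2026-09-05T03:25Z ∕ 03:35Z).
THEOREMS ONLY (no `def`, no `instance`, no notation, no named-fact hypothesis, no `sorry`).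
-/
import Summits.HodgeConjecture.HodgeConjecture.Theorems.K2LiuFinChirpLocalGramReading      -- ★ p863978 §1: ring-generic chirp∕Gram algebra
import Summits.HodgeConjecture.HodgeConjecture.Theorems.K2LiuSiegelUnipotentCharacters       -- ★ (A1): `unipDeltaChar_apply`, `trace_mul_skewProj`, `algebraMap_complexConj`
import Summits.HodgeConjecture.HodgeConjecture.Theorems.K2LiuUnipotentChart                  -- ★ `skew_of_mem_unipDelta`
import Summits.HodgeConjecture.HodgeConjecture.Theorems.K2LiuUnipDeltaCornerCoordinates      -- this lineage (g7) ★: `conjAdele_baseChange'`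
import Literature.NumberTheory.Weil1964.AdelicSecondDegreeCharacter                          -- ★ `sdChar`, `sdForm`
import Literature.NumberTheory.Weil1964.AdelicThetaDistribution                              -- ★ `ratPt`
import HarnessLib

/-!
# K2_Liu road (hLiu418 = stmt-HodgeConjecture-24832), FACE-D₀ route (B3), brick B3-2c-idx FILE 1∕2: `K2LiuKappaMultiplierIndexGramPrelim`

Cell `pub/hodgecm-mathlib` (D-0151), Track B, build stream 29; helper lane `--supports stmt-HodgeConjecture-24832 --as helper`, count-neutral; closes no socket.

WHY.  Route (B3) unfolds the Fourier coefficient of a doubled line theta lift along `N_Δ(L⁺)\N_Δ(𝔸)` in the rational κ-multiplier model (K2E3-p37's (KM′),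
B3-2b `K2LiuDoubledLineThetaCoeffUnfolding`): a Θ-fixing `Tg` (K2E3-p23 ★ B3-2c-op `K2LiuLinePairKappaModelChirpGlobal`: `Tg (ω(u) (Tg⁻¹ Ψ)) = t(S_u) Ψ` with
`S_u = (−½) · c_{q_u}` the chirp parameter in ★ p863869's CLOSED FORM) and an index map `Q : (Fin n″ → L⁺) → M_n(L)` with
`ψ_{L⁺}(q_{S_u}(ξ)) = ψ_{Q ξ}(u)` at every rational point `ξ` (FILE 2∕2 `K2LiuKappaMultiplierIndexGram`).  THIS FILE (the 400-line cut) holds the two organs: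
* §1 ring-generic bookkeeping: a quadratic form through `reindex`, the `Sum.elim` split, `1ᵀ`, a ring hom through a Gram matrix;
* §2 **the ADELIC Gram reading** `sdForm_chirpBlock_eq_two_mul_re` — the twin over `𝔸_L = 𝔸_{L⁺} ⊕ 𝔸_{L⁺} δ` (★ `isQuadraticCoordinates_adele`) of ★ p863978's local
  `chirpGram_eq_trace_of_blocks`: `⟨(p, q), ((−½)·(a′·J₂·Res(−X−X)·D₂(½)))(p, q)⟩ = 2 · re tr((δ · X T⁻¹) · ((a′∕(4d)) · σ(y) ⊗ y))`, `y = (pT) ⊗ 1 − 2δ (q ⊗ 1)`;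
* §3 **reality**: for `T_L`-skew `S` and `u ∈ N_Δ(𝔸)` the adele `tr(S_𝔸 · X_u)` is `c ⊗ 1`-fixed (★ `trace_mul_skewProj` at `Y := X_u`), and a `c ⊗ 1`-fixed adele is the
  base change of its real part (`eq_baseChange_re_of_conjAdele_eq`).
No definition, no instance, no notation, no named-fact hypothesis, no `sorry`; axioms ⊆ {propext, Classical.choice, Quot.sound}.
HONEST LABEL: organs only, closes no socket; HC_CM is proved only modulo the 7 printed citations (2 remaining named inputs: hLiu418 = stmt-HodgeConjecture-24832,
h413 = stmt-HodgeConjecture-24833) until rung 0 closes; count-neutral.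

References: [Kudla1994] S. S. Kudla, *Splitting metaplectic covers of dual reductive pairs*, Israel J. Math. 87 (1994), §2–§3 (the mixed model; Siegel unipotents act by
second-degree characters); [Weil1964] A. Weil, Acta Math. 111 (1964), Chap. I n° 13 p. 160, n° 34 p. 184; [KudlaRallis1994] S. Kudla, S. Rallis, Ann. of Math. 140 (1994), §3;
[Shimura1997] G. Shimura, *Euler products and Eisenstein series*, §18.1 (18.4); [CasselsFrohlichANT1967] Ch. II §14, Ch. XV §2.2; [Scharlau1985HermitianForms] Ch. 10 §1.
-/

set_option autoImplicit false
set_option linter.dupNamespace false -- the mandated namespace repeats `HodgeConjecture.HodgeConjecture`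

noncomputable section

open scoped Matrix
open NumberField IsDedekindDomain
open Literature.NumberTheory.Automorphic Literature.NumberTheory.Automorphic.UnitaryGroup
open Literature.NumberTheory.Automorphic.UnitaryGroup.QuadraticCoordinates
open Literature.NumberTheory.GelbartRogawski1991 Literature.NumberTheory.GelbartRogawski1991.GRConstruction
open Literature.NumberTheory.GelbartRogawski1991.UnitaryDualPair Literature.NumberTheory.GaloisRepresentations
open Literature.NumberTheory.Weil1964
open Literature.NumberTheory.K2Lit.SiegelDoubled
open Summit.HodgeConjecture.HodgeConjecture.Cruxes.HLiu418.K2LiuSiegelUnipotentFourierDefs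
open Summit.HodgeConjecture.HodgeConjecture.Cruxes.HLiu418.K2LiuSiegelUnipotentCharacters (trace_mul_skewProj algebraMap_complexConj)
open Summit.HodgeConjecture.HodgeConjecture.Cruxes.HLiu418.K2LiuUnipotentChart (skew_of_mem_unipDelta)
open Summit.HodgeConjecture.HodgeConjecture.Cruxes.HLiu418.K2LiuSiegelDoubledRationalPoints (gramRL_facts)
open Summit.HodgeConjecture.HodgeConjecture.Cruxes.HLiu418.K2LiuSiegelDoubledLeviMatrix (isUnit_det_gramRA)
open Summit.HodgeConjecture.HodgeConjecture.Cruxes.HLiu418.K2LiuFinChirpLocalGramReading (re_trace_chirpGram chirpGram_quadratic_form neg_half_smul_chirpBlock)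

namespace Summit.HodgeConjecture.HodgeConjecture.Cruxes.HLiu418.K2LiuKappaMultiplierIndexGramPrelim

/-! ## §1 Ring-generic bookkeeping -/

section Generic

variable {R : Type*} [CommRing R] {ι κ : Type*} [Fintype ι] [Fintype κ] [DecidableEq ι] [DecidableEq κ]

omit [DecidableEq ι] [DecidableEq κ] in
/-- a quadratic form through a re-enumeration: `⟨x, (reindex e e M) x⟩ = ⟨x ∘ e, M (x ∘ e)⟩`. [folklore] -/
theorem vecMul_reindex_dotProduct (e : ι ≃ κ) (M : Matrix ι ι R) (x : κ → R) :
    x ᵥ* Matrix.reindex e e M ⬝ᵥ x = (x ∘ e) ᵥ* M ⬝ᵥ (x ∘ e) := by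
  simp only [dotProduct, Matrix.vecMul, Matrix.reindex_apply, Matrix.submatrix_apply, Function.comp_apply]
  rw [← e.sum_comp]
  refine Finset.sum_congr rfl fun j _ => ?_
  rw [← e.sum_comp]
  simp only [Equiv.symm_apply_apply]

omit [Fintype ι] [DecidableEq ι] in
/-- the `Sum.elim` split of a vector on `ι ⊕ ι`. [folklore] -/
theorem sumElim_comp_inl_inr {α : Type*} (x : ι ⊕ ι → α) : Sum.elim (x ∘ Sum.inl) (x ∘ Sum.inr) = x :=
  Sum.elim_comp_inl_inr x

/-- `1ᵀ · N = N`. [folklore] -/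
theorem transpose_one_mul (N : Matrix ι ι R) : (1 : Matrix ι ι R)ᵀ * N = N := by
  rw [Matrix.transpose_one, Matrix.one_mul]

omit [Fintype ι] [DecidableEq ι] in
/-- a ring hom through a Gram matrix `σ(y) ⊗ y`: `(σ(y) ⊗ y).map f = σ′(f ∘ y) ⊗ (f ∘ y)` when `f ∘ σ = σ′ ∘ f`. [folklore] -/
theorem map_vecMulVec_conj {S : Type*} [CommRing S] (f : R →+* S) (σ : R → R) (σ' : S → S) (hσ : ∀ x, f (σ x) = σ' (f x)) (y : ι → R) :
    (Matrix.vecMulVec (σ ∘ y) y).map f = Matrix.vecMulVec (σ' ∘ (⇑f ∘ y)) (⇑f ∘ y) := by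
  ext i j
  simp only [Matrix.map_apply, Matrix.vecMulVec_apply, Function.comp_apply, map_mul, hσ]

end Generic

/-! ## §2 The adelic Gram reading of the chirp block (twin of ★ `chirpGram_eq_trace_of_blocks` over `𝔸_L = 𝔸_{L⁺} ⊕ 𝔸_{L⁺} δ`) -/

section Adele

variable (L : Type) [Field L] [NumberField L] [IsCMField L]
variable {ι : Type*} [Fintype ι] [DecidableEq ι]

/-- `(c ⊗ 1)(δ ⊗ 1) = −(δ ⊗ 1)` (★ `algebraMap_complexConj`, `c δ = −δ`). [folklore] -/
theorem conjAdele_algebraMap_imagUnit :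
    conjAdele (Fp L) L (IsCMField.complexConj L) (algebraMap L (AdeleRing (𝓞 L) L) (imagUnit L)) = -algebraMap L (AdeleRing (𝓞 L) L) (imagUnit L) := by
  rw [← algebraMap_complexConj, ← map_neg]
  exact congrArg _ (complexConj_imagUnit L)

/-- `re ((r ⊗ 1) · z) = r · re z` in the adelic quadratic coordinates. [folklore] -/
theorem re_baseChange_mul (r : AdeleRing (𝓞 (Fp L)) (Fp L)) (z : AdeleRing (𝓞 L) L) :
    re (quadraticAdeleEquiv (Fp L) L (IsCMField.complexConj L) (complexConj_imagUnit L) (imagUnit_ne_zero L)).toAddEquiv (AdeleRing.baseChange (Fp L) L r * z) =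
      r * re (quadraticAdeleEquiv (Fp L) L (IsCMField.complexConj L) (complexConj_imagUnit L) (imagUnit_ne_zero L)).toAddEquiv z := by
  have hq := isQuadraticCoordinates_adele L (IsCMField.complexConj L) (complexConj_imagUnit L) (imagUnit_ne_zero L) (imagUnit_mul_self L)
  conv_lhs => rw [← hq.re_add_im z, mul_add, ← mul_assoc, ← map_mul, ← map_mul, hq.re_eq]

/-- **THE ADELIC GRAM READING OF THE CHIRP BLOCK.**  Over `𝔸_L = 𝔸_{L⁺} ⊕ 𝔸_{L⁺} δ` (`δ = imagUnit L`, `δ² = d = imagUnitSq L`, ★ `isQuadraticCoordinates_adele`), for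
`X ∈ M_ι(𝔸_L)`, a symmetric invertible `T ∈ M_ι(𝔸_{L⁺})`, `p q : ι → 𝔸_{L⁺}` and `a′ ∈ L⁺`:
`⟨(p, q), ((−½) · (a′ · J₂ · Res(−X − X) · D₂(½)))(p, q)⟩ = 2 · re tr((δ · X T⁻¹) · ((a′∕(4d)) · σ(y) ⊗ y))` with `Res(Z) = (re Z, d · im Z · T⁻¹; T · im Z, T · re Z · T⁻¹)`,
`J₂ = (0, 1; −2·1, 0)`, `D₂(½) = (½·1, 0; 0, 1)`, `y_i = ((pT)_i ⊗ 1) − 2 ((q_i ⊗ 1) · δ)`, `σ = c ⊗ 1 = conjAdele` — ★ p863978 §1 (`re_trace_chirpGram`,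
`chirpGram_quadratic_form`, `neg_half_smul_chirpBlock`) at the adelic coordinates.  This is the block of ★ p863869 `aMat_cMat_lineKappa_of_mem_unipDelta` (.2) before
its `e₁′ ∘ e₂` re-enumeration. [cite: Kudla1994, §3] [cite: Weil1964, Chap. I n° 34 p. 184] [cite: KudlaRallis1994, §3] -/
theorem sdForm_chirpBlock_eq_two_mul_re (X : Matrix ι ι (AdeleRing (𝓞 L) L)) (T : Matrix ι ι (AdeleRing (𝓞 (Fp L)) (Fp L))) (hT : Tᵀ = T)
    (hTu : IsUnit T.det) (p q : ι → AdeleRing (𝓞 (Fp L)) (Fp L)) (a' : Fp L) :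
    Sum.elim p q ᵥ* ((-⅟(2 : AdeleRing (𝓞 (Fp L)) (Fp L))) • (algebraMap (Fp L) (AdeleRing (𝓞 (Fp L)) (Fp L)) a' •
        (Matrix.fromBlocks 0 1 (-((2 : AdeleRing (𝓞 (Fp L)) (Fp L)) • (1 : Matrix ι ι (AdeleRing (𝓞 (Fp L)) (Fp L))))) 0 *
          Matrix.fromBlocks ((-X - X).map (re (quadraticAdeleEquiv (Fp L) L (IsCMField.complexConj L) (complexConj_imagUnit L) (imagUnit_ne_zero L)).toAddEquiv))
            ((algebraMap (Fp L) (AdeleRing (𝓞 (Fp L)) (Fp L)) (imagUnitSq L)) •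
              ((-X - X).map (im (quadraticAdeleEquiv (Fp L) L (IsCMField.complexConj L) (complexConj_imagUnit L) (imagUnit_ne_zero L)).toAddEquiv) * T⁻¹))
            (T * (-X - X).map (im (quadraticAdeleEquiv (Fp L) L (IsCMField.complexConj L) (complexConj_imagUnit L) (imagUnit_ne_zero L)).toAddEquiv))
            (T * (-X - X).map (re (quadraticAdeleEquiv (Fp L) L (IsCMField.complexConj L) (complexConj_imagUnit L) (imagUnit_ne_zero L)).toAddEquiv) * T⁻¹) *
          Matrix.fromBlocks ((⅟(2 : AdeleRing (𝓞 (Fp L)) (Fp L))) • (1 : Matrix ι ι (AdeleRing (𝓞 (Fp L)) (Fp L)))) 0 0 1))) ⬝ᵥ Sum.elim p q =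
      2 * re (quadraticAdeleEquiv (Fp L) L (IsCMField.complexConj L) (complexConj_imagUnit L) (imagUnit_ne_zero L)).toAddEquiv (Matrix.trace
        ((algebraMap L (AdeleRing (𝓞 L) L) (imagUnit L) • (X * T⁻¹.map (AdeleRing.baseChange (Fp L) L))) *
          (AdeleRing.baseChange (Fp L) L (algebraMap (Fp L) (AdeleRing (𝓞 (Fp L)) (Fp L)) ((a' : Fp L) / (4 * imagUnitSq L))) •
            Matrix.vecMulVec (conjAdele (Fp L) L (IsCMField.complexConj L) ∘ fun i =>
                AdeleRing.baseChange (Fp L) L ((p ᵥ* T) i) - 2 * (AdeleRing.baseChange (Fp L) L (q i) * algebraMap L (AdeleRing (𝓞 L) L) (imagUnit L)))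
              (fun i => AdeleRing.baseChange (Fp L) L ((p ᵥ* T) i) - 2 * (AdeleRing.baseChange (Fp L) L (q i) * algebraMap L (AdeleRing (𝓞 L) L) (imagUnit L)))))) := by
  have hq := isQuadraticCoordinates_adele L (IsCMField.complexConj L) (complexConj_imagUnit L) (imagUnit_ne_zero L) (imagUnit_mul_self L)
  set reA := re (quadraticAdeleEquiv (Fp L) L (IsCMField.complexConj L) (complexConj_imagUnit L) (imagUnit_ne_zero L)).toAddEquiv with hreA
  set imA := im (quadraticAdeleEquiv (Fp L) L (IsCMField.complexConj L) (complexConj_imagUnit L) (imagUnit_ne_zero L)).toAddEquiv with himA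
  -- the `Res(−X − X)` block in the shape of ★ `neg_half_smul_chirpBlock`
  have hre : (-X - X).map reA = -((2 : AdeleRing (𝓞 (Fp L)) (Fp L)) • X.map reA) := by
    rw [Matrix.map_sub _ (map_sub _), Matrix.map_neg _ (map_neg _), two_smul]
    abel
  have him : (-X - X).map imA = -((2 : AdeleRing (𝓞 (Fp L)) (Fp L)) • X.map imA) := by
    rw [Matrix.map_sub _ (map_sub _), Matrix.map_neg _ (map_neg _), two_smul]
    abel
  have h2 : (2 : AdeleRing (𝓞 (Fp L)) (Fp L)) * ⅟(2 : AdeleRing (𝓞 (Fp L)) (Fp L)) = 1 := mul_invOf_self _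
  rw [hre, him, neg_half_smul_chirpBlock (⅟(2 : AdeleRing (𝓞 (Fp L)) (Fp L))) h2, Matrix.vecMul_smul, smul_dotProduct, smul_eq_mul,
    ← chirpGram_quadratic_form _ _ T T⁻¹ hT (Matrix.nonsing_inv_mul T hTu) _ p q]
  -- the right-hand side: pull the scalar `a′∕(4d) ⊗ 1` out of `re`, then ★ `re_trace_chirpGram`
  rw [Matrix.mul_smul, Matrix.trace_smul, smul_eq_mul, re_baseChange_mul,
    re_trace_chirpGram hq (conjAdele (Fp L) L (IsCMField.complexConj L)) (K2LiuUnipDeltaCornerCoordinates.conjAdele_baseChange' L) (conjAdele_algebraMap_imagUnit L) X T⁻¹ (p ᵥ* T) q]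
  -- scalars: `⅟2 · a′ = 2 · (a′∕(4d)) · d`
  have hd0 : (imagUnitSq L : Fp L) ≠ 0 := by
    intro h0
    have h1 : imagUnit L * imagUnit L = 0 := by rw [imagUnit_mul_self, h0, map_zero]
    exact imagUnit_ne_zero L (mul_self_eq_zero.1 h1)
  have h40 : (4 : Fp L) ≠ 0 := by norm_num
  have hscal : algebraMap (Fp L) (AdeleRing (𝓞 (Fp L)) (Fp L)) ((a' : Fp L) / (4 * imagUnitSq L)) * (4 * algebraMap (Fp L) (AdeleRing (𝓞 (Fp L)) (Fp L)) (imagUnitSq L)) =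
      algebraMap (Fp L) (AdeleRing (𝓞 (Fp L)) (Fp L)) a' := by
    rw [← map_ofNat (algebraMap (Fp L) (AdeleRing (𝓞 (Fp L)) (Fp L))) 4, ← map_mul, ← map_mul, div_mul_cancel₀ _ (mul_ne_zero h40 hd0)]
  have h4 : (4 : AdeleRing (𝓞 (Fp L)) (Fp L)) = 2 * 2 := by norm_num
  set A := algebraMap (Fp L) (AdeleRing (𝓞 (Fp L)) (Fp L)) ((a' : Fp L) / (4 * imagUnitSq L)) with hA
  set D := algebraMap (Fp L) (AdeleRing (𝓞 (Fp L)) (Fp L)) (imagUnitSq L) with hD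
  set B := ((X.map imA * T⁻¹) *ᵥ (p ᵥ* T)) ⬝ᵥ (p ᵥ* T) - 2 * (((X.map reA * T⁻¹) *ᵥ (p ᵥ* T)) ⬝ᵥ q) + 2 * (((X.map reA * T⁻¹) *ᵥ q) ⬝ᵥ (p ᵥ* T))
    - 4 * D * (((X.map imA * T⁻¹) *ᵥ q) ⬝ᵥ q) with hB
  calc ⅟(2 : AdeleRing (𝓞 (Fp L)) (Fp L)) * algebraMap (Fp L) (AdeleRing (𝓞 (Fp L)) (Fp L)) a' * B
      = ⅟(2 : AdeleRing (𝓞 (Fp L)) (Fp L)) * (A * (4 * D)) * B := by rw [hscal]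
    _ = (⅟(2 : AdeleRing (𝓞 (Fp L)) (Fp L)) * 2) * 2 * (A * (D * B)) := by rw [h4]; ring
    _ = 2 * (A * (D * B)) := by rw [invOf_mul_self, one_mul]

end Adele

/-! ## §3 Reality: `tr(S_𝔸 · X_u)` is `c ⊗ 1`-fixed for `T_L`-skew `S` and `u ∈ N_Δ(𝔸)`, hence a base change -/

section Real

variable (L : Type) [Field L] [NumberField L] [IsCMField L]
variable {N M n : ℕ} (e : Fin N × Fin M ≃ Fin n)
  (dV : Fin N → L) (hdV : ∀ i, IsCMField.complexConj L (dV i) = dV i) (hdV0 : ∀ i, dV i ≠ 0)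
  (dW : Fin M → L) (hdW : ∀ i, IsCMField.complexConj L (dW i) = dW i) (hdW0 : ∀ i, dW i ≠ 0)

/-- **a `c ⊗ 1`-FIXED adele is a base change**: `conjAdele t = t → t = (re t) ⊗ 1` (`t = (re t) ⊗ 1 + ((im t) ⊗ 1)·δ`, `c δ = −δ`, `2` and `d` are units).
[cite: CasselsFrohlichANT1967, Ch. II §14] -/
theorem eq_baseChange_re_of_conjAdele_eq {t : AdeleRing (𝓞 L) L} (ht : conjAdele (Fp L) L (IsCMField.complexConj L) t = t) :
    t = AdeleRing.baseChange (Fp L) L (re (quadraticAdeleEquiv (Fp L) L (IsCMField.complexConj L) (complexConj_imagUnit L) (imagUnit_ne_zero L)).toAddEquiv t) := by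
  have hq := isQuadraticCoordinates_adele L (IsCMField.complexConj L) (complexConj_imagUnit L) (imagUnit_ne_zero L) (imagUnit_mul_self L)
  set a := re (quadraticAdeleEquiv (Fp L) L (IsCMField.complexConj L) (complexConj_imagUnit L) (imagUnit_ne_zero L)).toAddEquiv t
  set b := im (quadraticAdeleEquiv (Fp L) L (IsCMField.complexConj L) (complexConj_imagUnit L) (imagUnit_ne_zero L)).toAddEquiv t
  have hdec : AdeleRing.baseChange (Fp L) L a + AdeleRing.baseChange (Fp L) L b * algebraMap L (AdeleRing (𝓞 L) L) (imagUnit L) = t := hq.re_add_im t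
  -- apply `c ⊗ 1`: the `δ`-part changes sign
  have hconj : conjAdele (Fp L) L (IsCMField.complexConj L) t =
      AdeleRing.baseChange (Fp L) L a - AdeleRing.baseChange (Fp L) L b * algebraMap L (AdeleRing (𝓞 L) L) (imagUnit L) := by
    conv_lhs => rw [← hdec]
    rw [map_add, map_mul, K2LiuUnipDeltaCornerCoordinates.conjAdele_baseChange', K2LiuUnipDeltaCornerCoordinates.conjAdele_baseChange',
      conjAdele_algebraMap_imagUnit, mul_neg, sub_eq_add_neg]
  have hbδ : AdeleRing.baseChange (Fp L) L b * algebraMap L (AdeleRing (𝓞 L) L) (imagUnit L) = 0 := by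
    have h2 : (2 : AdeleRing (𝓞 L) L) * (AdeleRing.baseChange (Fp L) L b * algebraMap L (AdeleRing (𝓞 L) L) (imagUnit L)) = 0 := by
      have h1 : AdeleRing.baseChange (Fp L) L a + AdeleRing.baseChange (Fp L) L b * algebraMap L (AdeleRing (𝓞 L) L) (imagUnit L) =
          AdeleRing.baseChange (Fp L) L a - AdeleRing.baseChange (Fp L) L b * algebraMap L (AdeleRing (𝓞 L) L) (imagUnit L) :=
        hdec.trans (ht.symm.trans hconj)
      linear_combination h1
    have h2u : IsUnit (2 : AdeleRing (𝓞 L) L) := isUnit_of_invertible 2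
    exact (h2u.mul_right_eq_zero).1 h2
  rw [← hdec, hbδ, add_zero]

include hdV0 hdW0 in
/-- **`tr(S_𝔸 · X_u)` IS `c ⊗ 1`-FIXED** for a `T_L`-skew rational `S` and `u ∈ N_Δ(𝔸)` (`X_u = (blk u)₁₂` is `T`-skew, ★ `skew_of_mem_unipDelta`; ★ `trace_mul_skewProj` at
`Y := X_u`: `tr(S · 2X_u) = tr(S X_u) + σ tr(S X_u)`). [cite: Shimura1997, §18.1 (18.4)] [cite: MoeglinWaldspurger1995, I.2.6] -/
theorem conjAdele_trace_mul_toBlocks₁₂ {S : Matrix (Fin n) (Fin n) L}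
    (hS : S ∈ skewMatrices ((IsCMField.complexConj L : L ≃ₐ[Fp L] L) : L →+* L) ((gramR L e dV hdV dW hdW).map (algebraMap (Fp L) L)))
    {u : HA L e dV hdV dW hdW} (hu : u ∈ unipDelta L e dV hdV dW hdW) :
    conjAdele (Fp L) L (IsCMField.complexConj L) (Matrix.trace (S.map (algebraMap L (AdeleRing (𝓞 L) L)) * (blk L e dV hdV dW hdW u).toBlocks₁₂)) =
      Matrix.trace (S.map (algebraMap L (AdeleRing (𝓞 L) L)) * (blk L e dV hdV dW hdW u).toBlocks₁₂) := by
  obtain ⟨-, -, -, hTLmap⟩ := gramRL_facts L e dV hdV dW hdW hdV0 hdW0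
  have hTu := isUnit_det_gramRA L e dV hdV dW hdW hdV0 hdW0
  have hSA : S.map (algebraMap L (AdeleRing (𝓞 L) L)) ∈ skewMatrices (conjAdele (Fp L) L (IsCMField.complexConj L))
      ((gramR L e dV hdV dW hdW).map ((algebraMap L (AdeleRing (𝓞 L) L)).comp (algebraMap (Fp L) L))) := by
    rw [← hTLmap]
    exact map_mem_skewMatrices (algebraMap L (AdeleRing (𝓞 L) L)) (algebraMap_complexConj L) hS
  have hX := skew_of_mem_unipDelta L e dV hdV dW hdW hu
  set X := (blk L e dV hdV dW hdW u).toBlocks₁₂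
  set TA := (gramR L e dV hdV dW hdW).map ((algebraMap L (AdeleRing (𝓞 L) L)).comp (algebraMap (Fp L) L))
  -- `X − T⁻¹ σ(X)ᵀ T = 2X` for the `T`-skew `X`
  have hXt : (X.map (conjAdele (Fp L) L (IsCMField.complexConj L)))ᵀ * TA = -(TA * X) := eq_neg_of_add_eq_zero_right hX
  have hproj : X - TA⁻¹ * (X.map (conjAdele (Fp L) L (IsCMField.complexConj L)))ᵀ * TA = X + X := by
    rw [Matrix.mul_assoc, hXt, Matrix.mul_neg, ← Matrix.mul_assoc, Matrix.nonsing_inv_mul TA hTu, Matrix.one_mul, sub_neg_eq_add]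
  have key := trace_mul_skewProj (conjAdele (Fp L) L (IsCMField.complexConj L)) hTu ((mem_skewMatrices_iff _ _ _).1 hSA) X
  rw [hproj, Matrix.mul_add, Matrix.trace_add] at key
  exact ((add_right_inj _).1 key).symm

end Real

end Summit.HodgeConjecture.HodgeConjecture.Cruxes.HLiu418.K2LiuKappaMultiplierIndexGramPrelim

end
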